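import Mathlib.NumberTheory.ModularForms.EisensteinSeries.QExpansion
import Mathlib.NumberTheory.LSeries.DirichletContinuation
import Mathlib.NumberTheory.LSeries.Dirichlet
import Mathlib.NumberTheory.DirichletCharacter.GaussSum
import Mathlib.NumberTheory.TsumDivisorsAntidiagonal
import HarnessLib

/-!
# The Eisenstein lattice sum with character `∑_{(c,d) ∈ ℤ²} ψ(d) (Ncz + d)^{-k}` (`k ≥ 3`):
# rows, Lipschitz, Gauss sums, and its `q`-expansion

Topic `Literature/NumberTheory/EllipticCurves` (next to `EisensteinSeriesNebentypus`); namespace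
`Literature.NumberTheory.EllipticCurves.ModularForms`.  THEOREMS ONLY (no definition, no named
fact).

For a Dirichlet character `ψ` modulo `N ≥ 1`, an integer `k ≥ 3` and `z ∈ ℍ` we study the
absolutely convergent lattice sum

  `G_ψ(z) = ∑_{(c,d) ∈ ℤ²} ψ(d) (N c z + d)^{-k}`

(the term `(0,0)` is `ψ(0)·0^{-k} = 0`), which is Miyake's / Billerey–Menares'
`G_k^{χ₁,χ₂}(𝔣₂ z) = ∑_{(m,n) ≠ (0,0)} χ₁(m) χ̄₂(n) (m 𝔣₂ z + n)^{-k}` for `χ₁ = 𝟙` (`𝔣₁ = 1`,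
`N = 𝔣₂`, `ψ = χ̄₂`) — Billerey–Menares 2018, §1.3; Miyake (7.1.1); Diamond–Shurman §4.5.  We prove,
entirely from Mathlib (level-one summability `summable_norm_eisSummand`, Lipschitz's formula
`EisensteinSeries.qExpansion_identity`, the Gauss-sum shift `gaussSum_mulShift_of_isPrimitive`,
`DirichletCharacter.LFunction_eq_LSeries`, and the divisor resummation `summable_prod_mul_pow`):

* `summable_eisLatticeChar` — absolute convergence for `k ≥ 3`;
* `eisLatticeChar_eq_tsum_rows` — `G_ψ = ∑_{m ∈ ℤ} R_m`, `R_m = ∑_{d ∈ ℤ} ψ(d)(Nmz + d)^{-k}`;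
* `eisLatticeCharRow_neg` — `R_{-m} = R_m` when `ψ(-1) = (-1)^k`;
* `eisLatticeCharRow_zero` — `R_0 = 2 L(k, ψ)`;
* `tsum_int_eq_sum_zmod_tsum` — `∑_{d ∈ ℤ} F(d) = ∑_{x mod N} ∑_{j ∈ ℤ} F(jN + x̃)`;
* `tsum_zpow_neg_eq_tsum_cexp` — Lipschitz: `∑_j (w+j)^{-k} = ((-2πi)^k/(k-1)!) ∑_n n^{k-1} e^{2πinw}`;
* `sum_apply_mul_cexp_pow` — `∑_{x mod N} ψ(x) e^{2πinx̃/N} = ψ̄(n) W(ψ)` for PRIMITIVE `ψ`;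
* `eisLatticeCharRow_pos` — for `m > 0` and primitive `ψ`:
  `R_m = (N^{-k}(-2πi)^k/(k-1)!) W(ψ) ∑_{n ≥ 0} ψ̄(n) n^{k-1} e^{2πinmz}`;
* `tsum_prod_mul_pow_eq_tsum_divisorSum` — `∑_{m,d ≥ 1} w(d) d^k r^{md} = ∑_n (∑_{d∣n} w(d)d^k) rⁿ`;
* `eisLatticeChar_eq_qExpansion` — **the `q`-expansion** (Billerey–Menares (7.1.13) with (7.1.3);
  Miyake Thm. 7.1.3; Diamond–Shurman Thm. 4.5.1): for `ψ` primitive with `ψ(-1) = (-1)^k`,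

  `G_ψ(z) = 2 L(k, ψ) + 2 · (-2πi)^k W(ψ) / (N^k (k-1)!) · ∑_{n ≥ 1} σ_{k-1}^{ψ̄}(n) qⁿ`,

  `q = e^{2πiz}`, `W(ψ) = ∑_x ψ(x) e^{2πix̃/N}`, `σ_{k-1}^{ψ̄}(n) = ∑_{d ∣ n} ψ̄(d) d^{k-1}`.

The companion file `EisensteinSeriesNebentypusQExpansion` identifies `G_ψ` with
`L(k, ψ) · E_k^{ψ̄}` (`eisensteinChar N k ψ⁻¹` of `EisensteinSeriesNebentypus`) and reads off the
`q`-expansion coefficients of the modular form `eisensteinCharMF`.  Deliberately NOT here: the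
identification of `2 L(k, ψ)` with `-B_{k,ψ̄}/2k` times the normalising constant (functional
equation), weights `1, 2`, imprimitive `ψ`, the other cusps.

## References

* N. Billerey, R. Menares, *Strong modularity of reducible Galois representations*, Trans. AMS 370
  (2018), §1.1, §1.3 ((7.1.13), citing Miyake Thm. 7.1.3 and (7.1.13)). [BillereyMenares2018]
* T. Miyake, *Modular Forms*, Springer (2006), §7.1, Thm. 7.1.3. [Miyake2006]
* F. Diamond, J. Shurman, *A First Course in Modular Forms*, GTM 228 (2005), §4.5, Thm. 4.5.1.
  [DiamondShurman2005]
-/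

noncomputable section

open Complex UpperHalfPlane EisensteinSeries Filter Finset
open scoped Real

namespace Literature.NumberTheory.EllipticCurves.ModularForms

/-! ### The double-sum resummation `∑_{m,d} w(d) d^k r^{md} = ∑_n σ_k^w(n) rⁿ` -/

section Resummation

/-- The double family `(m, d) ↦ w(d) d^k r^{md}` on `ℕ₊²` is summable for `‖r‖ < 1` and a
weight `|w| ≤ 1` (comparison with Mathlib `summable_prod_mul_pow`). [folklore] -/
theorem summable_prod_weight_mul_pow (k : ℕ) {r : ℂ} (hr : ‖r‖ < 1) (w : ℕ → ℂ)
    (hw : ∀ d, ‖w d‖ ≤ 1) :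
    Summable fun c : ℕ+ × ℕ+ ↦ w c.2 * (c.2 : ℂ) ^ k * r ^ (c.1 * c.2 : ℕ) := by
  refine Summable.of_norm_bounded (summable_prod_mul_pow k hr).norm fun c ↦ ?_
  rw [mul_assoc, norm_mul]
  exact mul_le_of_le_one_left (norm_nonneg _) (hw _)

/-- **Resummation of the double series**: for `‖r‖ < 1` and a weight `w` bounded by `1`,
`∑_{(m,d) ∈ ℕ₊²} w(d) d^k r^{md} = ∑_{n ≥ 1} (∑_{d ∣ n} w(d) d^k) rⁿ` (absolute convergence
and the bijection `(m, d) ↦ n = md`, Mathlib `sigmaAntidiagonalEquivProd`). [folklore] -/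
theorem tsum_prod_mul_pow_eq_tsum_divisorSum (k : ℕ) {r : ℂ} (hr : ‖r‖ < 1) (w : ℕ → ℂ)
    (hw : ∀ d, ‖w d‖ ≤ 1) :
    ∑' c : ℕ+ × ℕ+, w c.2 * (c.2 : ℂ) ^ k * r ^ (c.1 * c.2 : ℕ) =
      ∑' n : ℕ+, (∑ d ∈ (n : ℕ).divisors, w d * (d : ℂ) ^ k) * r ^ (n : ℕ) := by
  have hs' := sigmaAntidiagonalEquivProd.summable_iff.mpr (summable_prod_weight_mul_pow k hr w hw)
  simp only [Function.comp_def] at hs'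
  rw [← sigmaAntidiagonalEquivProd.tsum_eq, hs'.tsum_sigma]
  refine tsum_congr fun n ↦ ?_
  rw [tsum_fintype, Finset.sum_mul]
  simp only [sigmaAntidiagonalEquivProd, divisorsAntidiagonalFactors, Equiv.coe_fn_mk, PNat.mk_coe]
  rw [Finset.univ_eq_attach,
    (n : ℕ).divisorsAntidiagonal.sum_attach fun x : ℕ × ℕ ↦ w x.2 * (x.2 : ℂ) ^ k * r ^ (x.1 * x.2),
    Nat.sum_divisorsAntidiagonal' fun x y ↦ w y * (y : ℂ) ^ k * r ^ (x * y)]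
  refine Finset.sum_congr rfl fun d hd ↦ ?_
  rw [Nat.div_mul_cancel (Nat.dvd_of_mem_divisors hd)]

end Resummation

/-! ### The lattice sum and its rows -/

section Lattice

variable {N : ℕ} [NeZero N] (k : ℕ) (ψ : DirichletCharacter ℂ N) (z : ℍ)

/-- `(c, d) ↦ (Nc, d)` is injective on `ℤ²` for `N ≠ 0`. [folklore] -/
theorem scaleFst_injective :
    Function.Injective fun v : Fin 2 → ℤ ↦ (![(N : ℤ) * v 0, v 1] : Fin 2 → ℤ) := by
  intro v w h
  have h0 := congr_fun h 0
  have h1 := congr_fun h 1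
  simp only [Matrix.cons_val_zero, Matrix.cons_val_one, Matrix.cons_val_fin_one] at h0 h1
  funext i
  fin_cases i
  · exact mul_left_cancel₀ (by exact_mod_cast NeZero.ne N) h0
  · exact h1

omit [NeZero N] in
/-- The summand of `G_ψ` is `ψ(d) (Ncz + d)^{-k}`. [folklore] -/
theorem eisSummand_scaleFst (v : Fin 2 → ℤ) :
    eisSummand k ![(N : ℤ) * v 0, v 1] z = ((N : ℂ) * v 0 * z + v 1) ^ (-(k : ℤ)) := by
  simp [eisSummand]

/-- **Absolute convergence of `G_ψ = ∑_{(c,d)} ψ(d)(Ncz+d)^{-k}` for `k ≥ 3`** (a sub-family of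
the level-one lattice sum, Mathlib `summable_norm_eisSummand`, weighted by `|ψ| ≤ 1`).
[cite: BillereyMenares2018, §1.3] -/
theorem summable_eisLatticeChar (hk : 3 ≤ k) :
    Summable fun v : Fin 2 → ℤ ↦ ψ (v 1) * eisSummand k ![(N : ℤ) * v 0, v 1] z := by
  have hs : Summable fun v : Fin 2 → ℤ ↦ ‖eisSummand (k : ℤ) ![(N : ℤ) * v 0, v 1] z‖ :=
    (summable_norm_eisSummand (by exact_mod_cast hk) z).comp_injective (scaleFst_injective (N := N))
  refine Summable.of_norm_bounded hs fun v ↦ ?_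
  rw [norm_mul]
  exact mul_le_of_le_one_left (norm_nonneg _) (ψ.norm_le_one _)

/-- The summand of `G_ψ` as a function on `ℤ × ℤ` is summable (`k ≥ 3`). [folklore] -/
theorem summable_eisLatticeChar_prod (hk : 3 ≤ k) :
    Summable fun x : ℤ × ℤ ↦ ψ x.2 * ((N : ℂ) * x.1 * z + x.2) ^ (-(k : ℤ)) := by
  refine (finTwoArrowEquiv ℤ).summable_iff.mp <| (summable_eisLatticeChar k ψ z hk).congr ?_
  intro v
  simp [eisSummand]

/-- Each row `R_m = ∑_{d ∈ ℤ} ψ(d) (Nmz + d)^{-k}` is absolutely convergent (`k ≥ 3`). [folklore] -/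
theorem summable_eisLatticeCharRow (hk : 3 ≤ k) (m : ℤ) :
    Summable fun d : ℤ ↦ ψ d * ((N : ℂ) * m * z + d) ^ (-(k : ℤ)) :=
  (summable_eisLatticeChar_prod k ψ z hk).prod_factor m

/-- The rows `m ↦ R_m` form a summable family (`k ≥ 3`). [folklore] -/
theorem summable_tsum_eisLatticeCharRow (hk : 3 ≤ k) :
    Summable fun m : ℤ ↦ ∑' d : ℤ, ψ d * ((N : ℂ) * m * z + d) ^ (-(k : ℤ)) :=
  (summable_eisLatticeChar_prod k ψ z hk).prod

/-- **`G_ψ = ∑_{m ∈ ℤ} R_m`** (Fubini for the absolutely convergent double sum). [folklore] -/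
theorem eisLatticeChar_eq_tsum_rows (hk : 3 ≤ k) :
    ∑' v : Fin 2 → ℤ, ψ (v 1) * eisSummand k ![(N : ℤ) * v 0, v 1] z =
      ∑' (m : ℤ) (d : ℤ), ψ d * ((N : ℂ) * m * z + d) ^ (-(k : ℤ)) := by
  rw [← (finTwoArrowEquiv ℤ).symm.tsum_eq]
  simp only [finTwoArrowEquiv_symm_apply, Matrix.cons_val_one, Matrix.cons_val_fin_one,
    Matrix.cons_val_zero, eisSummand, Int.cast_mul, Int.cast_natCast]
  exact (summable_eisLatticeChar_prod k ψ z hk).tsum_prod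

end Lattice

/-! ### Decomposing a sum over `ℤ` into residue classes modulo `N` -/

section Residues

variable (N : ℕ) [NeZero N]

/-- **Summing over `ℤ` by residue classes**: for a summable `F : ℤ → ℂ`,
`∑_{d ∈ ℤ} F(d) = ∑_{x mod N} ∑_{j ∈ ℤ} F(jN + x̃)`, `x̃ ∈ {0, …, N-1}` the representative of `x`
(the bijection `ℤ/Nℤ × ℤ ≃ ℤ`, `(x, j) ↦ jN + x̃`). [folklore] -/
theorem tsum_int_eq_sum_zmod_tsum {F : ℤ → ℂ} (hF : Summable F) :
    ∑' d : ℤ, F d = ∑ x : ZMod N, ∑' j : ℤ, F (j * N + (x.val : ℤ)) := by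
  have hN : (0 : ℤ) < N := by exact_mod_cast Nat.pos_of_ne_zero (NeZero.ne N)
  let e : ZMod N × ℤ ≃ ℤ :=
    { toFun := fun p ↦ p.2 * N + (p.1.val : ℤ)
      invFun := fun d ↦ ((d : ZMod N), d / N)
      left_inv := fun p ↦ by
        obtain ⟨x, j⟩ := p
        have hv : ((x.val : ℤ)) / N = 0 :=
          Int.ediv_eq_zero_of_lt (by positivity) (by exact_mod_cast x.val_lt)
        refine Prod.ext ?_ ?_
        · simp [ZMod.intCast_cast]
        · simp only
          rw [add_comm, Int.add_mul_ediv_right _ _ hN.ne', hv, zero_add]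
      right_inv := fun d ↦ by
        simp only [ZMod.val_intCast]
        linear_combination Int.ediv_mul_add_emod d N }
  have hF' := e.summable_iff.mpr hF
  simp only [Function.comp_def] at hF'
  rw [← e.tsum_eq, hF'.tsum_prod, tsum_fintype]
  rfl

/-- The residue class of `jN + x̃` is `x`. [folklore] -/
theorem intCast_mul_add_val (j : ℤ) (x : ZMod N) :
    (((j * N + (x.val : ℤ) : ℤ)) : ZMod N) = x := by
  push_cast
  simp

end Residues

/-! ### The Lipschitz formula in weight `k`, negative-power form -/

section Lipschitz

/-- **Lipschitz's formula** (Mathlib `EisensteinSeries.qExpansion_identity`) in the form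
`∑_{j ∈ ℤ} (w + j)^{-k} = ((-2πi)^k/(k-1)!) ∑_{n ≥ 0} n^{k-1} e^{2πi n w}` for `w ∈ ℍ`, `k ≥ 2`.
[folklore] -/
theorem tsum_zpow_neg_eq_tsum_cexp {k : ℕ} (hk : 2 ≤ k) (w : ℍ) :
    ∑' j : ℤ, ((w : ℂ) + j) ^ (-(k : ℤ)) =
      (-2 * π * Complex.I) ^ k / (k - 1).factorial *
        ∑' n : ℕ, (n : ℂ) ^ (k - 1) * cexp (2 * π * Complex.I * w) ^ n := by
  have h := EisensteinSeries.qExpansion_identity (k := k - 1) (by omega) w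
  rw [show k - 1 + 1 = k by omega] at h
  rw [← h]
  refine tsum_congr fun j ↦ ?_
  rw [zpow_neg, zpow_natCast, one_div]

/-- Summability of `n ↦ n^k (e^{2πi w})^n` for `w ∈ ℍ`. [folklore] -/
theorem summable_pow_mul_cexp_pow (k : ℕ) (w : ℍ) :
    Summable fun n : ℕ ↦ (n : ℂ) ^ k * cexp (2 * π * Complex.I * w) ^ n := by
  simpa using summable_pow_mul_cexp k 1 w

end Lipschitz

/-! ### The rows of `G_ψ`: symmetry, the row `m = 0`, and the rows `m > 0` -/

section Rows

variable {N : ℕ} [NeZero N] (k : ℕ) (ψ : DirichletCharacter ℂ N) (z : ℍ)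

omit [NeZero N] in
/-- Parity bookkeeping: `ψ(-d) (-x)^{-k} = ψ(d) x^{-k}` when `ψ(-1) = (-1)^k`. [folklore] -/
theorem apply_neg_mul_neg_zpow (hpar : ψ (-1) = (-1) ^ k) (d : ℤ) (x : ℂ) :
    ψ (((-d : ℤ)) : ZMod N) * (-x) ^ (-(k : ℤ)) = ψ (d : ZMod N) * x ^ (-(k : ℤ)) := by
  rw [Int.cast_neg, ← neg_one_mul ((d : ℤ) : ZMod N), map_mul, hpar, neg_eq_neg_one_mul x,
    mul_zpow]
  have h1 : ((-1 : ℂ) ^ k) * (-1 : ℂ) ^ (-(k : ℤ)) = 1 := by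
    rw [zpow_neg, zpow_natCast, mul_inv_cancel₀ (pow_ne_zero _ (neg_ne_zero.mpr one_ne_zero))]
  calc (-1 : ℂ) ^ k * ψ (d : ZMod N) * ((-1 : ℂ) ^ (-(k : ℤ)) * x ^ (-(k : ℤ)))
      = ((-1 : ℂ) ^ k * (-1) ^ (-(k : ℤ))) * (ψ (d : ZMod N) * x ^ (-(k : ℤ))) := by ring
    _ = ψ (d : ZMod N) * x ^ (-(k : ℤ)) := by rw [h1, one_mul]

omit [NeZero N] in
/-- **Row symmetry**: `R_{-m} = R_m` when `ψ(-1) = (-1)^k` (substitute `d ↦ -d`). [folklore] -/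
theorem eisLatticeCharRow_neg (hpar : ψ (-1) = (-1) ^ k) (m : ℤ) :
    ∑' d : ℤ, ψ d * ((N : ℂ) * ((-m : ℤ) : ℂ) * z + d) ^ (-(k : ℤ)) =
      ∑' d : ℤ, ψ d * ((N : ℂ) * m * z + d) ^ (-(k : ℤ)) := by
  rw [← (Equiv.neg ℤ).tsum_eq]
  refine tsum_congr fun d ↦ ?_
  rw [Equiv.neg_apply]
  have h : ((N : ℂ) * ((-m : ℤ) : ℂ) * z + ((-d : ℤ) : ℂ)) = -((N : ℂ) * m * z + d) := by
    push_cast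
    ring
  rw [h, apply_neg_mul_neg_zpow k ψ hpar]

/-- **The row `m = 0`**: `R_0 = ∑_{d ∈ ℤ} ψ(d) d^{-k} = 2 L(k, ψ)` for `ψ(-1) = (-1)^k`, `k ≥ 3`
(the terms `±d` agree; Mathlib `DirichletCharacter.LFunction_eq_LSeries`).
[cite: BillereyMenares2018, §1.3 (constant term of (7.1.13))] -/
theorem eisLatticeCharRow_zero (hk : 3 ≤ k) (hpar : ψ (-1) = (-1) ^ k) :
    ∑' d : ℤ, ψ d * ((N : ℂ) * ((0 : ℤ) : ℂ) * z + d) ^ (-(k : ℤ)) = 2 * ψ.LFunction k := by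
  simp only [Int.cast_zero, mul_zero, zero_mul, zero_add]
  have hs : Summable fun d : ℤ ↦ ψ d * ((d : ℤ) : ℂ) ^ (-(k : ℤ)) := by
    simpa using summable_eisLatticeCharRow k ψ z hk 0
  have heven : Function.Even fun d : ℤ ↦ ψ d * ((d : ℤ) : ℂ) ^ (-(k : ℤ)) := by
    intro d
    simp only [Int.cast_neg]
    have := apply_neg_mul_neg_zpow k ψ hpar d ((d : ℤ) : ℂ)
    rwa [Int.cast_neg] at this
  rw [tsum_int_eq_zero_add_two_mul_tsum_pnat heven hs]
  simp only [Int.cast_zero]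
  rw [zero_zpow _ (by simp; omega), mul_zero, zero_add, nsmul_eq_mul, Nat.cast_ofNat]
  congr 1
  have hre : 1 < ((k : ℂ)).re := by simp; omega
  rw [DirichletCharacter.LFunction_eq_LSeries ψ hre, LSeries]
  have h0 : (fun n : ℕ ↦ LSeries.term (fun n : ℕ ↦ ψ n) k n) 0 = 0 := LSeries.term_zero _ _
  rw [← tsum_pnat_eq_tsum_of_eq_zero (M := ℂ) h0]
  refine tsum_congr fun n ↦ ?_
  rw [LSeries.term_of_ne_zero (PNat.ne_zero n), div_eq_mul_inv, Complex.cpow_natCast,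
    ← zpow_natCast, ← zpow_neg]
  push_cast
  rfl

/-- **One residue class of a row** (`m > 0`): with `w = m z + x̃/N ∈ ℍ`,
`∑_{j ∈ ℤ} ψ(jN + x̃) (Nmz + jN + x̃)^{-k} = ψ(x) N^{-k} ∑_j (w + j)^{-k}`, and Lipschitz's formula
turns the last sum into `((-2πi)^k/(k-1)!) ∑_n n^{k-1} e^{2πi n x̃/N} e^{2πi n m z}`.
[cite: BillereyMenares2018, §1.3 ((7.1.13) via Miyake2006 Thm. 7.1.3)] -/
theorem tsum_residue_row (hk : 3 ≤ k) {m : ℤ} (hm : 0 < m) (x : ZMod N) :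
    ∑' j : ℤ, ψ (((j * N + (x.val : ℤ) : ℤ)) : ZMod N) *
        ((N : ℂ) * m * z + ((j * N + (x.val : ℤ) : ℤ) : ℂ)) ^ (-(k : ℤ)) =
      ψ x * ((N : ℂ) ^ k)⁻¹ * ((-2 * π * Complex.I) ^ k / (k - 1).factorial) *
        ∑' n : ℕ, (n : ℂ) ^ (k - 1) *
          (cexp (2 * π * Complex.I * x.val / N) ^ n * cexp (2 * π * Complex.I * m * z) ^ n) := by
  have hN : (N : ℂ) ≠ 0 := by exact_mod_cast NeZero.ne N
  have him : 0 < ((m : ℂ) * z + (x.val : ℂ) / N).im := by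
    rw [Complex.add_im, Complex.div_natCast_im]
    simp only [Complex.mul_im, Complex.intCast_re, Complex.intCast_im, zero_mul, add_zero,
      Complex.natCast_im, UpperHalfPlane.coe_im, zero_div]
    exact mul_pos (Int.cast_pos.mpr hm) z.im_pos
  set w : ℍ := ⟨(m : ℂ) * z + (x.val : ℂ) / N, him⟩ with hw
  have hwc : (w : ℂ) = (m : ℂ) * z + (x.val : ℂ) / N := rfl
  have hterm : ∀ j : ℤ, ψ (((j * N + (x.val : ℤ) : ℤ)) : ZMod N) *
      ((N : ℂ) * m * z + ((j * N + (x.val : ℤ) : ℤ) : ℂ)) ^ (-(k : ℤ)) =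
      ψ x * ((N : ℂ) ^ k)⁻¹ * ((w : ℂ) + j) ^ (-(k : ℤ)) := by
    intro j
    rw [intCast_mul_add_val]
    have h : ((N : ℂ) * m * z + ((j * N + (x.val : ℤ) : ℤ) : ℂ)) = (N : ℂ) * ((w : ℂ) + j) := by
      rw [hwc]
      push_cast
      field_simp
      ring
    rw [h, mul_zpow, zpow_neg (N : ℂ), zpow_natCast, mul_assoc]
  simp_rw [hterm]
  rw [tsum_mul_left, tsum_zpow_neg_eq_tsum_cexp (by omega) w, ← mul_assoc]
  congr 1
  refine tsum_congr fun n ↦ ?_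
  rw [← mul_pow, ← Complex.exp_add, hwc]
  congr 3
  ring

/-- **The Gauss-sum step**: for a PRIMITIVE `ψ`,
`∑_{x mod N} ψ(x) e^{2πi n x̃/N} = ψ̄(n) W(ψ)` with `W(ψ) = ∑_x ψ(x) e^{2πi x̃/N}` the Gauss sum
(Mathlib `gaussSum_mulShift_of_isPrimitive`; both sides vanish for `(n, N) > 1`).
[cite: BillereyMenares2018, §1.1 (`W(φ)`), §1.3] -/
theorem sum_apply_mul_cexp_pow (hψ : ψ.IsPrimitive) (n : ℕ) :
    ∑ x : ZMod N, ψ x * cexp (2 * π * Complex.I * x.val / N) ^ n =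
      ψ⁻¹ n * gaussSum ψ (ZMod.stdAddChar (N := N)) := by
  rw [← gaussSum_mulShift_of_isPrimitive (ZMod.stdAddChar (N := N)) hψ, gaussSum]
  refine Finset.sum_congr rfl fun x _ ↦ ?_
  congr 1
  rw [AddChar.mulShift_apply, ← Complex.exp_nat_mul]
  have hx : ((n : ZMod N)) * x = (((n : ℤ) * (x.val : ℤ) : ℤ) : ZMod N) := by
    push_cast
    simp
  rw [hx, ZMod.stdAddChar_coe]
  congr 1
  push_cast
  ring

/-- **The rows `m > 0`** for a primitive `ψ`:
`R_m = (N^{-k} (-2πi)^k/(k-1)!) W(ψ) ∑_{n ≥ 0} ψ̄(n) n^{k-1} e^{2πi n m z}`.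
[cite: BillereyMenares2018, §1.3 ((7.1.13) via Miyake2006 Thm. 7.1.3)] -/
theorem eisLatticeCharRow_pos (hk : 3 ≤ k) (hψ : ψ.IsPrimitive) {m : ℤ} (hm : 0 < m) :
    ∑' d : ℤ, ψ d * ((N : ℂ) * m * z + d) ^ (-(k : ℤ)) =
      ((N : ℂ) ^ k)⁻¹ * ((-2 * π * Complex.I) ^ k / (k - 1).factorial) *
        gaussSum ψ (ZMod.stdAddChar (N := N)) *
        ∑' n : ℕ, ψ⁻¹ n * (n : ℂ) ^ (k - 1) * cexp (2 * π * Complex.I * m * z) ^ n := by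
  rw [tsum_int_eq_sum_zmod_tsum N (summable_eisLatticeCharRow k ψ z hk m)]
  rw [Finset.sum_congr rfl fun x _ ↦ tsum_residue_row k ψ z hk hm x]
  -- summability of the inner series, for the interchange
  have hq : ∀ x : ZMod N, Summable fun n : ℕ ↦ (n : ℂ) ^ (k - 1) *
      (cexp (2 * π * Complex.I * x.val / N) ^ n * cexp (2 * π * Complex.I * m * z) ^ n) := by
    intro x
    have him : 0 < ((m : ℂ) * z + (x.val : ℂ) / N).im := by
      rw [Complex.add_im, Complex.div_natCast_im]
      simp only [Complex.mul_im, Complex.intCast_re, Complex.intCast_im, zero_mul, add_zero,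
        Complex.natCast_im, UpperHalfPlane.coe_im, zero_div]
      exact mul_pos (Int.cast_pos.mpr hm) z.im_pos
    refine (summable_pow_mul_cexp_pow (k - 1) ⟨_, him⟩).congr fun n ↦ ?_
    rw [← mul_pow, ← Complex.exp_add]
    congr 3
    push_cast
    ring
  calc ∑ x : ZMod N, ψ x * ((N : ℂ) ^ k)⁻¹ * ((-2 * π * Complex.I) ^ k / (k - 1).factorial) *
        ∑' n : ℕ, (n : ℂ) ^ (k - 1) *
          (cexp (2 * π * Complex.I * x.val / N) ^ n * cexp (2 * π * Complex.I * m * z) ^ n)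
      = ((N : ℂ) ^ k)⁻¹ * ((-2 * π * Complex.I) ^ k / (k - 1).factorial) *
        ∑' n : ℕ, ∑ x : ZMod N, ψ x * cexp (2 * π * Complex.I * x.val / N) ^ n *
          ((n : ℂ) ^ (k - 1) * cexp (2 * π * Complex.I * m * z) ^ n) := by
        rw [Summable.tsum_finsetSum fun x _ ↦ ((hq x).mul_left (ψ x)).congr fun n ↦ by ring,
          Finset.mul_sum]
        refine Finset.sum_congr rfl fun x _ ↦ ?_
        rw [← tsum_mul_left, ← tsum_mul_left]
        refine tsum_congr fun n ↦ ?_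
        ring
    _ = _ := by
        rw [mul_assoc (((N : ℂ) ^ k)⁻¹ * _) (gaussSum ψ _), ← tsum_mul_left (a := gaussSum ψ _)]
        congr 1
        refine tsum_congr fun n ↦ ?_
        rw [← Finset.sum_mul, sum_apply_mul_cexp_pow ψ hψ n]
        ring

end Rows

/-! ### The `q`-expansion of `G_ψ` -/

section QExpansion

variable {N : ℕ} [NeZero N] (k : ℕ) (ψ : DirichletCharacter ℂ N) (z : ℍ)

/-- **The `q`-expansion of the Eisenstein lattice sum with character** (Billerey–Menares 2018,
(7.1.13) with (7.1.3), from Miyake Thm. 7.1.3; Diamond–Shurman Thm. 4.5.1): for a PRIMITIVE `ψ`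
modulo `N` with `ψ(-1) = (-1)^k` and `k ≥ 3`,

  `∑_{(c,d) ∈ ℤ²} ψ(d) (Ncz + d)^{-k}
     = 2 L(k, ψ) + 2 · ((-2πi)^k / (N^k (k-1)!)) · W(ψ) · ∑_{n ≥ 1} σ_{k-1}^{ψ̄}(n) qⁿ`,

`q = e^{2πiz}`, `W(ψ)` the Gauss sum, `σ_{k-1}^{ψ̄}(n) = ∑_{d ∣ n} ψ̄(d) d^{k-1}`.
[cite: BillereyMenares2018, §1.3 (7.1.13)] -/
theorem eisLatticeChar_eq_qExpansion (hk : 3 ≤ k) (hψ : ψ.IsPrimitive)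
    (hpar : ψ (-1) = (-1) ^ k) :
    ∑' v : Fin 2 → ℤ, ψ (v 1) * eisSummand k ![(N : ℤ) * v 0, v 1] z = 2 * ψ.LFunction k +
      2 * (((N : ℂ) ^ k)⁻¹ * ((-2 * π * Complex.I) ^ k / (k - 1).factorial) *
          gaussSum ψ (ZMod.stdAddChar (N := N))) *
        ∑' n : ℕ+, (∑ d ∈ (n : ℕ).divisors, ψ⁻¹ d * (d : ℂ) ^ (k - 1)) *
          cexp (2 * π * Complex.I * z) ^ (n : ℕ) := by
  rw [eisLatticeChar_eq_tsum_rows k ψ z hk]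
  have heven : Function.Even fun m : ℤ ↦ ∑' d : ℤ, ψ d * ((N : ℂ) * m * z + d) ^ (-(k : ℤ)) :=
    fun m ↦ by simpa using eisLatticeCharRow_neg k ψ z hpar m
  rw [tsum_int_eq_zero_add_two_mul_tsum_pnat heven (summable_tsum_eisLatticeCharRow k ψ z hk)]
  rw [eisLatticeCharRow_zero k ψ z hk hpar, nsmul_eq_mul, Nat.cast_ofNat, mul_assoc (2 : ℂ) (_ * _)]
  congr 2
  have hpos : ∀ m : ℕ+, (0 : ℤ) < ((m : ℕ) : ℤ) := fun m ↦ by exact_mod_cast m.pos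
  rw [show (∑' m : ℕ+, ∑' d : ℤ, ψ d * ((N : ℂ) * ((m : ℕ) : ℤ) * z + d) ^ (-(k : ℤ))) =
      ∑' m : ℕ+, ((N : ℂ) ^ k)⁻¹ * ((-2 * π * Complex.I) ^ k / (k - 1).factorial) *
        gaussSum ψ (ZMod.stdAddChar (N := N)) *
        ∑' n : ℕ, ψ⁻¹ n * (n : ℂ) ^ (k - 1) * cexp (2 * π * Complex.I * ((m : ℕ) : ℤ) * z) ^ n
      from tsum_congr fun m ↦ eisLatticeCharRow_pos k ψ z hk hψ (hpos m), tsum_mul_left]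
  congr 1
  have hq : ‖cexp (2 * π * Complex.I * z)‖ < 1 := norm_exp_two_pi_I_lt_one z
  have hinner : ∀ m : ℕ+,
      ∑' n : ℕ, ψ⁻¹ n * (n : ℂ) ^ (k - 1) * cexp (2 * π * Complex.I * ((m : ℕ) : ℤ) * z) ^ n =
        ∑' n : ℕ+, ψ⁻¹ n * (n : ℂ) ^ (k - 1) *
          cexp (2 * π * Complex.I * z) ^ ((m : ℕ) * n : ℕ) := by
    intro m
    have h0 : (fun n : ℕ ↦ ψ⁻¹ n * (n : ℂ) ^ (k - 1) *
        cexp (2 * π * Complex.I * ((m : ℕ) : ℤ) * z) ^ n) 0 = 0 := by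
      simp only [Nat.cast_zero, zero_pow (show k - 1 ≠ 0 by omega), mul_zero, zero_mul]
    rw [← tsum_pnat_eq_tsum_of_eq_zero (M := ℂ) h0]
    refine tsum_congr fun n ↦ ?_
    rw [pow_mul, ← Complex.exp_nat_mul (2 * π * Complex.I * z) m]
    congr 3
    push_cast
    ring
  simp_rw [hinner]
  rw [← (summable_prod_weight_mul_pow (k - 1) hq (fun d ↦ ψ⁻¹ d)
    (fun d ↦ ψ⁻¹.norm_le_one _)).tsum_prod,
    tsum_prod_mul_pow_eq_tsum_divisorSum (k - 1) hq (fun d ↦ ψ⁻¹ d) (fun d ↦ ψ⁻¹.norm_le_one _)]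

end QExpansion

end Literature.NumberTheory.EllipticCurves.ModularForms
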